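import Literature.Computability.Complexity.SearchToDecision

/-!
# PneNP / OverlapGapAlgebra — support `SearchFromDecision` (stmt-PneNP-11243)

Route `PneNP/OverlapGapAlgebra`, support item stmt-PneNP-11243 (`SearchFromDecision`, rank 9), the
search-to-decision hypothesis `hS` of the route's deciding theorem `closes`:

  if `NP ⊆ P` (tree classes `Nondeterministic.NP`, `Classes.P`), then for every relation `R ∈ P`
  (a language of pairs `boolPair x y`) and every polynomial `p` there is `g ∈ FP` which, on every
  `x` admitting some `y` with `|y| ≤ p(|x|)` and `⟨x, y⟩ ∈ R`, returns such a `y`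
  (`|g x| ≤ p(|x|)` and `⟨x, g x⟩ ∈ R`).

This is verbatim the PROVED Literature theorem
`Literature.Computability.Complexity.exists_searchFn_of_NP_subset_P` (`SearchToDecision.lean`;
Arora–Barak 2009, Thm. 2.18; Goldreich 2001, §2.7.4, Exercise 2), with the relation `R` and its
`P`-membership bound explicitly (`∀ R ∈ Classes.P`) as in the item's signature; the proof is one line.

The statement is spelled STRUCTURALLY — token for token the body of the route decl
`Summit.PneNP.PneNP.Theses.OverlapGapAlgebra.SearchFromDecision`, so that
`example : SearchFromDecision := by exact overlapGapAlgebra_searchFromDecision_proof` closes by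
unfolding — and this file deliberately does NOT import the route file
`Summits.PneNP.PneNP.Theses.OverlapGapAlgebra`: the gate links a proved item by importing the proving
module INTO the route file (`theorem SearchFromDecision_holds : SearchFromDecision := …`), which a
module importing the route file would turn into an import cycle (cf.
`Theorems/SzkEntropyCookModelBridgeStandalone.lean`). The import cone this adds to the route consists
of sorry-free machine/transducer files without named facts (`SearchToDecision` and its plumbing).

References: S. Arora, B. Barak, *Computational Complexity: A Modern Approach*, CUP 2009, §2.5,
Thm. 2.18 (decision versus search); O. Goldreich, *Foundations of Cryptography I: Basic Tools*,
CUP 2001, §2.7.4, Exercise 2 (guideline).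
-/

namespace Summit.PneNP.PneNP.Theorems

open Literature.Computability.Complexity

/-- **`SearchFromDecision` holds** (route `OverlapGapAlgebra`, item stmt-PneNP-11243): search
reduces to decision under `NP ⊆ P` — for every relation `R ∈ P` and polynomial `p` some `g ∈ FP`
returns, on every `x` that has an `R`-witness of length `≤ p(|x|)`, such a witness `g x`
(`|g x| ≤ p(|x|)` and `⟨x, g x⟩ ∈ R`). One line over the proved tree theorem
`exists_searchFn_of_NP_subset_P` (Arora–Barak 2009, Thm. 2.18; Goldreich 2001, §2.7.4, Ex. 2); the
type is literally the body of `Summit.PneNP.PneNP.Theses.OverlapGapAlgebra.SearchFromDecision`. -/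
theorem overlapGapAlgebra_searchFromDecision_proof :
    Literature.Computability.Complexity.Nondeterministic.NP ⊆ Literature.Computability.Complexity.Classes.P → ∀ R ∈ Literature.Computability.Complexity.Classes.P, ∀ p : Polynomial ℕ, ∃ g ∈ Literature.Computability.Complexity.FP, ∀ x : List Bool, (∃ y : List Bool, y.length ≤ p.eval x.length ∧ Literature.Computability.Complexity.boolPair x y ∈ R) → (g x).length ≤ p.eval x.length ∧ Literature.Computability.Complexity.boolPair x (g x) ∈ R :=
  fun hNP _R hR p => exists_searchFn_of_NP_subset_P hNP hR p

end Summit.PneNP.PneNP.Theorems
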